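import Literature.NumberTheory.Automorphic.CuspidalCohomologyGL
import Literature.NumberTheory.Automorphic.GLnCornerEmbedding
import Mathlib.LinearAlgebra.Dual.Lemmas
import Mathlib.LinearAlgebra.Finsupp.LinearCombination
import HarnessLib

/-!
# Relative modular symbols for `GL_{m+1} ⊃ GL_m` over `ℚ`: symbol presentations and their relation module

Topic `NumberTheory/Automorphic` (definition request `defn-RelativeModularSymbolPresentation`, route
`Langlands/CriticalCocycle`, cruxes `CohomologicalConverse`, `CocycleIdentity`), on top of
`CuspidalCohomologyGL` (the receptacle `H^{b_n}_!(S(K_f(N)), Ṽ_λ ⊗ ℂ)`).  Namespace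
`Literature.NumberTheory.Automorphic`; sub-namespaces `SymbolPresentation` (abstract, fully proved)
and `RelativeModularSymbol` (the `GL_{m+1} ⊃ GL_m` symbol names); headline object
`Literature.NumberTheory.Automorphic.RelativeModularSymbolPresentation m N wt`.

## The mathematics being named

Write `n = m + 1`, `j : GL_m → GL_{m+1}`, `h ↦ diag(h, 1)` (`GLn.cornerSucc`), `b_n = ⌊n²/4⌋`
(`GLnCohomology.bottomDegree`; `b_{m+1} + b_m - 1 = dim SL_m(ℝ)/SO(m)`).  For `g ∈ GL_{m+1}(𝔸_f)`
the map of adelic locally symmetric spaces `F_g : S_m(K'_f) → S_{m+1}(K_f)`,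
`[y, hK'_f] ↦ [j(y), j(h) g K_f]` (`K'_f ⊆ j⁻¹(g K_f g⁻¹)`; classically, for `u ∈ GL_{m+1}(ℚ)⁺` and
`g = u_f⁻¹`, the proper map `J_u : Γ'_u\X_m → Γ\X_{m+1}`, `Γ'_u y ↦ Γ u j(y)`) is proper, and
integrating a fast decreasing (= compactly supported up to cohomology, Borel) `b_{m+1}`-class of the
big space over this relative cycle against a `b_m`-class `c'` of the small space — first along the
fibre `ℝ_{>0}` of `X_m → X_m^1`, then over `S_m`, through a `GL_m`-invariant linear form on the
coefficients `V_λ ⊗ V_{λ'}` — is the **relative modular symbol**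
`𝒫_g(·, c') : H^{b_{m+1}}_{cusp}(S_{m+1}(K_f(N)), Ṽ_λ) → ℂ`
[cite: KastenSchmidt2012, §3.1–§3.5 (the pairing B_u)]
[cite: KazhdanMazurSchmidt2000, §3.3 and p. 102 (as used in KastenSchmidt2012 §3.1)]
[cite: Schmidt1993, Introduction]
[cite: Januszewski2011, Prop. 1.4 and the definition of 𝒫^q_{s,g}].  A `GL_m`-invariant form on
`V_λ ⊗ V_{λ'}` exists (and is then unique up to scalar) iff `λ ≻ λ'^∨` (interlacing,
`RelativeModularSymbol.Interlaces`: `λ₁ ≥ λ'^∨₁ ≥ λ₂ ≥ ⋯ ≥ λ'^∨_m ≥ λ_{m+1}`), which for cohomological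
cuspidal `π` on `GL_{m+1}` (coefficients `V_λ`) and `τ` on `GL_m` (coefficients `V_{λ'}`) is the
condition making `s = ½` critical for `L(s, π × τ)` [cite: Raghuram2009, §2 and Thm. 1.1]; the other
critical points are reached by the twists `λ' ↦ λ' + j(1,…,1)` (`τ ↦ τ ⊗ |·|^j`).  MAIN THEOREM of the
theory (NOT vendored here, see below): on the class of a cohomological cusp form of `π` and the class
`c'` of one of `τ`, suitable Gauss-sum-weighted sums over `g` of these symbols equal
`P_∞(κ) · (local factors) · L(κ, (π ⊗ χ) × τ)` at the critical point `κ`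
[cite: KastenSchmidt2012, Thm. A] [cite: Raghuram2009, Thm. 1.1]
[cite: KazhdanMazurSchmidt2000, p. 123 (as used in KastenSchmidt2012 §3.6)],
with `P_∞(κ) ≠ 0` [cite: Sun2016, Thm. A].  For `m = 1` (`GL_2 ⊃ GL_1`, `λ = (k−2, 0)`, `λ' = (a)`,
interlacing `⟺ 0 ≤ −a ≤ k − 2`) these are the classical modular symbols
`∫_{g0}^{g∞} f(z) zʲ dz`, `j ∈ {0, …, k − 2}` (`j = −a` or `k − 2 + a` according to the normalisation
of `V_λ`), and their twists by Dirichlet characters (= classes in `H⁰` of `GL_1`), whose values are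
the critical values `L(f, χ, j + 1)` [cite: Manin1972, §1] [cite: MazurTateTeitelbaum1986, §I.8];
compare the weight-`2` analytic symbols `Literature.NumberTheory.EllipticCurves.ModularForms.modularSymbol`
and the weight-`k` Manin module `ManinK` of the tree.

## What this file constructs (no axioms, no `sorry`, no named facts)

**A. Abstract symbol presentations (`SymbolPresentation`, fully proved).**  For a field `k`, a
`k`-space `H` (the receptacle) and a map `ev : S → Module.Dual k H` from a type `S` of symbol NAMES:
* `relationModule ev ⊆ (S →₀ k)`, the kernel of `∑ aₛ[s] ↦ ∑ aₛ ev s` — the **relation module**;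
* `periodVector ev x = (s ↦ ev s x)`, the vector of periods of a class `x`;
* `Kills Φ R` (`Φ : S → k` extended linearly vanishes on `R`), `IsSpanning ev` (the symbols separate
  the points of `H`), `IsGeneratedBy F ev` (`F` spans the relation module);
* THEOREMS: `kills_relationModule_iff_exists_dual` (over any field: `Φ` kills the relation module iff
  `Φ` factors through a linear functional on `Dual H`), its finite-dimensional form
  `kills_relationModule_iff` (**`Φ` kills all relations iff `Φ` is the period vector of a class**),
  `IsSpanning.eq_of_periodVector_eq` (that class is then unique), `isSpanning_of_span_eq_top`,
  `kills_relationModule_iff_of_isGeneratedBy` (finitely many identities to check when `F` is finite),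
  and the coincidence relations `single_sub_single_mem_relationModule` etc.
This is the linear algebra behind "a value vector is a cohomology class iff it kills the relations".

**B. The `GL_{m+1} ⊃ GL_m` names and presentations (`RelativeModularSymbol`).**
* `Interlaces μ ν` with `Interlaces.antitone_left/right` (both weights are then dominant) and the
  `m = 1` calibration `interlaces_two_iff`;
* `Name m`: a symbol name `[g, λ', N', c']` = `g ∈ GL_{m+1}(𝔸_ℚ^∞)` (`BigHeckeGLn.FiniteAdelicGL`), a
  weight `λ'` of `GL_m`, a level `N'` and a class `c' ∈ H^{b_m}(S_m(K_f(N')), Ṽ_{λ'} ⊗ ℂ)`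
  (`GLnCohomology.levelCohomology`); `Name.IsEigen` (the class is a Satake eigenclass off `N'`);
* `RelativeModularSymbolPresentation m N wt`: a **system of relative modular symbols** with values in
  the dual of `CuspidalCohomologyGL (m+1) N wt` — the symbol `symbol g λ' N'`, `ℂ`-linear in `c'`,
  subject to the formal properties of the construction recalled above: it vanishes unless
  `Interlaces wt λ'^∨` (no invariant form on the coefficients), it is invariant under `g ↦ g u`,
  `u ∈ K_f(N)` (`F_{gu} = F_g`), and under `g ↦ j(u') g`, `u' ∈ K_f^{(m)}(N')` (`F_{j(u')g} = F_g ∘ R_{u'}`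
  with `R_{u'}` the identity of `S_m(K_f(N'))`) — relations (b) "`g ∼ g h`" of the request;
* its API: `eval`, `rel` (THE RELATION MODULE of the presentation), `Kills`, `periodVector`,
  `IsSpanning`, `IsGeneratedBy`; the relations (a) (linearity in `c'`), (b) (double cosets) and the
  vanishing of non-interlacing names as members of `rel`; the duality theorem `kills_iff_exists_eq`
  and `kills_iff_of_isGeneratedBy` specialised; the zero presentation (`Inhabited`).

## Design notes (what is deliberately NOT here, and why)

* The symbol MAP itself is structure data, not constructed: the printed construction evaluates a
  compactly supported class on a relative fundamental cycle, i.e. uses Poincaré duality /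
  integration on `Γ'\X_m`; in the tree's purely group-cohomological model
  (`TwistedQuotient.cohomology`) the relevant top-degree group cohomology of `Γ'` vanishes
  (`vcd Γ' < dim X_m`), so the pairing is invisible without a compactly supported theory and its
  trace map, neither of which exists in Mathlib or the tree.  The structure records exactly the
  formal properties the cited constructions visibly have (the tree's `PolySymbol` of
  `ManinSymbolsWeightK` is the `GL_2` precedent of axiomatising a symbol system by its relations).
  On `H_! ⊋ H_cusp` (non-regular `wt`, `m + 1 ≥ 3`) the printed functional is only defined on cuspidal
  classes (via their canonical fast decreasing representatives [cite: KastenSchmidt2012, §3.5 and §3.8]);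
  a presentation extends it arbitrarily.
* NOT here: the critical-value formula as a named fact (it needs the Eichler–Shimura/Borel map from
  cusp FORMS to classes, the `π₀(K_∞)`-sign components and the normalisation of critical points in
  the tree's arithmetic Satake normalisation — none available; see `CuspidalCohomologyGL`, "NOT here");
  the Hecke (distribution) relations of the symbols [cite: Januszewski2011, §4] (the tree's
  Hecke operators are not yet restricted to `H_!`); orientation/`π₀(K_∞)` relations; "apartment"
  (Ash–Rudolph/sharbly) relations, which concern a different symbol [cite: AshRudolph1979]; any claim
  that a named family GENERATES `rel` (exposed as the predicate `IsGeneratedBy`, to be asserted by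
  whoever conjectures it); the critical-value functional of a Galois representation (a route object).

## References

* D. Kazhdan, B. Mazur, C.-G. Schmidt, *Relative modular symbols and Rankin–Selberg convolutions*,
  J. reine angew. Math. 519 (2000), 97–141 [KazhdanMazurSchmidt2000].
* C.-G. Schmidt, *Relative modular symbols and p-adic Rankin–Selberg convolutions*, Invent. Math.
  112 (1993) [Schmidt1993].
* H. Kasten, C.-G. Schmidt, *The critical values of Rankin–Selberg convolutions*, Int. J. Number
  Theory 9 (2013), §3 and Thm. A [KastenSchmidt2012].
* F. Januszewski, *Modular symbols for reductive groups and p-adic Rankin–Selberg convolutions over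
  number fields*, J. reine angew. Math. 653 (2011), §1 (Prop. 1.4, `𝒫^q_{s,g}`) [Januszewski2011].
* A. Raghuram, *On the special values of certain Rankin–Selberg L-functions …*, IMRN 2010, §2,
  Thm. 1.1 [Raghuram2009]; B. Sun, *The nonvanishing hypothesis at infinity for Rankin–Selberg
  convolutions*, JAMS 30 (2017) [Sun2016].
* Ju. I. Manin, *Parabolic points and zeta functions of modular curves* (1972), §1 [Manin1972];
  B. Mazur, J. Tate, J. Teitelbaum (1986), §I.8 [MazurTateTeitelbaum1986];
  A. Ash, L. Rudolph, Invent. Math. 55 (1979) [AshRudolph1979].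
-/

noncomputable section

namespace Literature.NumberTheory.Automorphic

/-! ## A. Abstract symbol presentations -/

namespace SymbolPresentation

variable {k : Type*} [Field k] {H : Type*} [AddCommGroup H] [Module k H] {S : Type*}

/-- The **relation module** of a symbol map `ev : S → Dual H`: the kernel of the linear extension
`(S →₀ k) → Dual H`, `∑ aₛ [s] ↦ ∑ aₛ ev s`, i.e. the formal linear combinations of symbol names
that vanish identically on the receptacle `H`. [folklore] -/
def relationModule (ev : S → Module.Dual k H) : Submodule k (S →₀ k) :=
  LinearMap.ker (Finsupp.linearCombination k ev)

/-- Membership in the relation module: the linear combination of functionals is zero. [folklore] -/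
theorem mem_relationModule_iff (ev : S → Module.Dual k H) (r : S →₀ k) :
    r ∈ relationModule ev ↔ Finsupp.linearCombination k ev r = 0 :=
  LinearMap.mem_ker

/-- Membership in the relation module, pointwise on `H`: `∑ₛ r(s) · ev s x = 0` for every class `x`.
[folklore] -/
theorem mem_relationModule_iff_forall (ev : S → Module.Dual k H) (r : S →₀ k) :
    r ∈ relationModule ev ↔ ∀ x : H, (r.sum fun s a => a * ev s x) = 0 := by
  rw [mem_relationModule_iff, LinearMap.ext_iff]
  refine forall_congr' fun x => ?_
  rw [Finsupp.linearCombination_apply, LinearMap.zero_apply, Finsupp.sum, Finsupp.sum,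
    LinearMap.coe_sum, Finset.sum_apply]
  simp only [LinearMap.smul_apply, smul_eq_mul]

/-- The **period vector** of a class `x ∈ H`: the value vector `s ↦ ev s x` on symbol names.
[folklore] -/
def periodVector (ev : S → Module.Dual k H) (x : H) : S → k :=
  fun s => ev s x

/-- Unfolding lemma for `periodVector`. [folklore] -/
@[simp]
theorem periodVector_apply (ev : S → Module.Dual k H) (x : H) (s : S) :
    periodVector ev x s = ev s x :=
  rfl

/-- A value vector `Φ : S → k` **kills** a submodule `R` of formal combinations of names if its
linear extension `∑ aₛ [s] ↦ ∑ aₛ Φ(s)` vanishes on `R`. [folklore] -/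
def Kills (Φ : S → k) (R : Submodule k (S →₀ k)) : Prop :=
  R ≤ LinearMap.ker (Finsupp.linearCombination k Φ)

/-- Unfolding lemma for `Kills`. [folklore] -/
theorem kills_iff (Φ : S → k) (R : Submodule k (S →₀ k)) :
    Kills Φ R ↔ ∀ r ∈ R, Finsupp.linearCombination k Φ r = 0 :=
  Iff.rfl

/-- `Kills` is antitone in the submodule. [folklore] -/
theorem Kills.mono {Φ : S → k} {R R' : Submodule k (S →₀ k)} (h : Kills Φ R) (hR : R' ≤ R) :
    Kills Φ R' :=
  hR.trans h

/-- The linear extension of a period vector is evaluation of the extension of `ev`. [folklore] -/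
theorem linearCombination_periodVector (ev : S → Module.Dual k H) (x : H) (r : S →₀ k) :
    Finsupp.linearCombination k (periodVector ev x) r = Finsupp.linearCombination k ev r x := by
  rw [Finsupp.linearCombination_apply, Finsupp.linearCombination_apply, Finsupp.sum, Finsupp.sum,
    LinearMap.coe_sum, Finset.sum_apply]
  simp only [periodVector_apply, LinearMap.smul_apply, smul_eq_mul]

/-- **Period vectors kill the relation module** (the trivial direction: relations among the
functionals are relations among their values). [folklore] -/
theorem kills_relationModule_periodVector (ev : S → Module.Dual k H) (x : H) :
    Kills (periodVector ev x) (relationModule ev) := by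
  intro r hr
  rw [LinearMap.mem_ker, linearCombination_periodVector, (mem_relationModule_iff ev r).1 hr,
    LinearMap.zero_apply]

/-- **Duality, general form.** A value vector kills the relation module of `ev` iff it factors
through a linear functional on `Dual H` along `ev` (over a field every functional on the range of
`∑ aₛ[s] ↦ ∑ aₛ ev s` extends to `Dual H`). [folklore] -/
theorem kills_relationModule_iff_exists_dual (ev : S → Module.Dual k H) (Φ : S → k) :
    Kills Φ (relationModule ev) ↔
      ∃ ψ : Module.Dual k (Module.Dual k H), ∀ s, Φ s = ψ (ev s) := by
  constructor
  · intro h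
    set T : (S →₀ k) →ₗ[k] Module.Dual k H := Finsupp.linearCombination k ev with hT
    have hker : LinearMap.ker T ≤ LinearMap.ker (Finsupp.linearCombination k Φ) := h
    let φ₁ : LinearMap.range T →ₗ[k] k :=
      ((LinearMap.ker T).liftQ (Finsupp.linearCombination k Φ) hker) ∘ₗ
        (T.quotKerEquivRange.symm : LinearMap.range T →ₗ[k] (S →₀ k) ⧸ LinearMap.ker T)
    obtain ⟨ψ, hψ⟩ := φ₁.exists_extend
    refine ⟨ψ, fun s => ?_⟩
    have hs : T (Finsupp.single s 1) = ev s := by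
      rw [hT, Finsupp.linearCombination_single, one_smul]
    have h1 : ψ (T (Finsupp.single s 1)) =
        φ₁ ⟨T (Finsupp.single s 1), LinearMap.mem_range_self T _⟩ := by
      rw [← hψ]
      rfl
    have h2 : φ₁ ⟨T (Finsupp.single s 1), LinearMap.mem_range_self T _⟩ =
        Finsupp.linearCombination k Φ (Finsupp.single s 1) := by
      simp only [φ₁, LinearMap.coe_comp, LinearEquiv.coe_coe, Function.comp_apply,
        LinearMap.quotKerEquivRange_symm_apply_image, Submodule.mkQ_apply, Submodule.liftQ_apply]
    have h3 : Finsupp.linearCombination k Φ (Finsupp.single s 1) = Φ s := by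
      rw [Finsupp.linearCombination_single, one_smul]
    calc Φ s = ψ (T (Finsupp.single s 1)) := by rw [h1, h2, h3]
      _ = ψ (ev s) := by rw [hs]
  · rintro ⟨ψ, hψ⟩ r hr
    have hΦ : Φ = ψ ∘ ev := funext hψ
    rw [LinearMap.mem_ker, hΦ, Finsupp.linearCombination_linear_comp, LinearMap.comp_apply,
      (mem_relationModule_iff ev r).1 hr, map_zero]

/-- **Duality (finite-dimensional receptacle): a value vector kills every relation among the
symbols iff it is the period vector of a class.**  This is the linear algebra underlying any
statement of the form "`Φ` is a cohomology class iff `Φ` satisfies the relations of the symbols".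
[folklore] -/
theorem kills_relationModule_iff [FiniteDimensional k H] (ev : S → Module.Dual k H) (Φ : S → k) :
    Kills Φ (relationModule ev) ↔ ∃ x : H, Φ = periodVector ev x := by
  rw [kills_relationModule_iff_exists_dual]
  constructor
  · rintro ⟨ψ, hψ⟩
    refine ⟨(Module.evalEquiv k H).symm ψ, funext fun s => ?_⟩
    rw [hψ, periodVector_apply, Module.apply_evalEquiv_symm_apply]
  · rintro ⟨x, rfl⟩
    exact ⟨Module.Dual.eval k H x, fun s => rfl⟩

/-- The symbols **span** (separate the points of) the receptacle: a class all of whose periods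
vanish is zero.  For finite-dimensional `H` this says that the `ev s` span `Dual H`. [folklore] -/
def IsSpanning (ev : S → Module.Dual k H) : Prop :=
  ∀ x : H, (∀ s, ev s x = 0) → x = 0

/-- Under spanning, a class is determined by its period vector. [folklore] -/
theorem IsSpanning.eq_of_periodVector_eq {ev : S → Module.Dual k H} (h : IsSpanning ev) {x y : H}
    (hxy : periodVector ev x = periodVector ev y) : x = y := by
  rw [← sub_eq_zero]
  refine h _ fun s => ?_
  rw [map_sub, sub_eq_zero]
  exact congrFun hxy s

/-- If the functionals `ev s` span `Dual H`, the symbols are spanning. [folklore] -/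
theorem isSpanning_of_span_eq_top {ev : S → Module.Dual k H}
    (h : Submodule.span k (Set.range ev) = ⊤) : IsSpanning ev := by
  intro x hx
  refine (Module.forall_dual_apply_eq_zero_iff k x).1 fun φ => ?_
  have hφ : φ ∈ Submodule.span k (Set.range ev) := h ▸ Submodule.mem_top
  induction hφ using Submodule.span_induction with
  | mem f hf =>
    obtain ⟨s, rfl⟩ := hf
    exact hx s
  | zero => rfl
  | add f g _ _ hf hg => rw [LinearMap.add_apply, hf, hg, add_zero]
  | smul c f _ hf => rw [LinearMap.smul_apply, hf, smul_zero]

/-- In finite dimension, the symbols are spanning iff the functionals `ev s` span `Dual H`.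
[folklore] -/
theorem isSpanning_iff_span_eq_top [FiniteDimensional k H] (ev : S → Module.Dual k H) :
    IsSpanning ev ↔ Submodule.span k (Set.range ev) = ⊤ := by
  refine ⟨fun h => ?_, isSpanning_of_span_eq_top⟩
  by_contra hne
  obtain ⟨F, hF0, hF⟩ :=
    Submodule.exists_dual_map_eq_bot_of_lt_top (lt_top_iff_ne_top.2 hne) inferInstance
  apply hF0
  have hx : (Module.evalEquiv k H).symm F = 0 := by
    refine h _ fun s => ?_
    rw [Module.apply_evalEquiv_symm_apply]
    have : F (ev s) ∈ (Submodule.span k (Set.range ev)).map F :=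
      Submodule.mem_map_of_mem (Submodule.subset_span (Set.mem_range_self s))
    rwa [hF, Submodule.mem_bot] at this
  simpa using hx

/-- Under spanning and finite dimension, a value vector killing the relations is the period vector
of a UNIQUE class. [folklore] -/
theorem existsUnique_of_kills [FiniteDimensional k H] {ev : S → Module.Dual k H} (h : IsSpanning ev)
    {Φ : S → k} (hΦ : Kills Φ (relationModule ev)) : ∃! x : H, Φ = periodVector ev x := by
  obtain ⟨x, rfl⟩ := (kills_relationModule_iff ev Φ).1 hΦ
  exact ⟨x, rfl, fun y hy => (h.eq_of_periodVector_eq hy).symm⟩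

/-- A family `F` of formal combinations **generates** the relation module (a finite presentation
when `F` is finite). [folklore] -/
def IsGeneratedBy (F : Set (S →₀ k)) (ev : S → Module.Dual k H) : Prop :=
  Submodule.span k F = relationModule ev

/-- With a generating family, killing the relation module is the list of identities
`∑ₛ f(s) Φ(s) = 0`, `f ∈ F`. [folklore] -/
theorem kills_relationModule_iff_of_isGeneratedBy {F : Set (S →₀ k)} {ev : S → Module.Dual k H}
    (hF : IsGeneratedBy F ev) (Φ : S → k) :
    Kills Φ (relationModule ev) ↔ ∀ f ∈ F, Finsupp.linearCombination k Φ f = 0 := by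
  rw [Kills, ← hF, Submodule.span_le]
  rfl

/-- Coincidence relation: names with the same functional give the relation `[s] − [t]`. [folklore] -/
theorem single_sub_single_mem_relationModule {ev : S → Module.Dual k H} {s t : S}
    (h : ev s = ev t) : Finsupp.single s 1 - Finsupp.single t 1 ∈ relationModule ev := by
  rw [mem_relationModule_iff, map_sub, Finsupp.linearCombination_single,
    Finsupp.linearCombination_single, h, sub_self]

/-- Proportionality relation: `ev s = c • ev t` gives `[s] − c[t]` (orientation/sign relations
are the case `c = ±1`). [folklore] -/
theorem single_sub_smul_single_mem_relationModule {ev : S → Module.Dual k H} {s t : S} {c : k}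
    (h : ev s = c • ev t) : Finsupp.single s 1 - c • Finsupp.single t 1 ∈ relationModule ev := by
  rw [mem_relationModule_iff, map_sub, map_smul, Finsupp.linearCombination_single,
    Finsupp.linearCombination_single, h, one_smul, one_smul, sub_self]

/-- A name with the zero functional is itself a relation. [folklore] -/
theorem single_mem_relationModule {ev : S → Module.Dual k H} {s : S} (h : ev s = 0) :
    Finsupp.single s 1 ∈ relationModule ev := by
  rw [mem_relationModule_iff, Finsupp.linearCombination_single, h, smul_zero]

/-- Additivity relation: `ev s = ev t + ev u` gives `[s] − [t] − [u]`. [folklore] -/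
theorem single_sub_single_sub_single_mem_relationModule {ev : S → Module.Dual k H} {s t u : S}
    (h : ev s = ev t + ev u) :
    Finsupp.single s 1 - Finsupp.single t 1 - Finsupp.single u 1 ∈ relationModule ev := by
  rw [mem_relationModule_iff, map_sub, map_sub, Finsupp.linearCombination_single,
    Finsupp.linearCombination_single, Finsupp.linearCombination_single, h, one_smul, one_smul,
    one_smul, add_sub_cancel_left, sub_self]

end SymbolPresentation

/-! ## B. The relative modular symbols of `GL_{m+1} ⊃ GL_m` over `ℚ` -/

namespace RelativeModularSymbol

open GLnCohomology Literature.NumberTheory.DiophantineGeometry _root_.NumberField _root_.IsDedekindDomain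

/-- **Interlacing** `μ ≻ ν` of a weight `μ` of `GL_{m+1}` and a weight `ν` of `GL_m`:
`μ₁ ≥ ν₁ ≥ μ₂ ≥ ν₂ ≥ ⋯ ≥ ν_m ≥ μ_{m+1}` — the condition of the classical branching law
`M_μ|_{GL_m} ≅ ⊕_{μ ≻ ν} M_ν` (dominant `μ`), "which ensures that `M_ν` appears in the restriction to
`GL_m` of `M_μ`; in fact it appears with multiplicity one". [cite: Raghuram2009, §2 (notation μ ≻ λ)] -/
def Interlaces {m : ℕ} (μ : Fin (m + 1) → ℤ) (ν : Fin m → ℤ) : Prop :=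
  ∀ i : Fin m, ν i ≤ μ i.castSucc ∧ μ i.succ ≤ ν i

/-- Interlacing of explicit weights is decidable (finitely many integer inequalities). [folklore] -/
instance {m : ℕ} (μ : Fin (m + 1) → ℤ) (ν : Fin m → ℤ) : Decidable (Interlaces μ ν) :=
  inferInstanceAs (Decidable (∀ i : Fin m, ν i ≤ μ i.castSucc ∧ μ i.succ ≤ ν i))

/-- An interlaced big weight is dominant (antitone). [folklore] -/
theorem Interlaces.antitone_left {m : ℕ} {μ : Fin (m + 1) → ℤ} {ν : Fin m → ℤ}
    (h : Interlaces μ ν) : Antitone μ :=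
  Fin.antitone_iff_succ_le.2 fun i => (h i).2.trans (h i).1

/-- An interlacing small weight is dominant (antitone). [folklore] -/
theorem Interlaces.antitone_right :
    ∀ {m : ℕ} {μ : Fin (m + 1) → ℤ} {ν : Fin m → ℤ}, Interlaces μ ν → Antitone ν
  | 0, _, _, _ => fun a _ _ => a.elim0
  | _ + 1, _, _, h => Fin.antitone_iff_succ_le.2 fun i =>
      ((h i.succ).1.trans (le_of_eq (congrArg _ (Fin.succ_castSucc i).symm))).trans (h i.castSucc).2

/-- Interlacing weights are dominant in the tree's sense (`Weight.IsDominant` = antitone), big side.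
[folklore] -/
theorem Interlaces.isDominant_left {m : ℕ} {μ : Fin (m + 1) → ℤ} {ν : Fin m → ℤ}
    (h : Interlaces μ ν) : Weight.IsDominant μ :=
  h.antitone_left

/-- Interlacing weights are dominant in the tree's sense, small side. [folklore] -/
theorem Interlaces.isDominant_right {m : ℕ} {μ : Fin (m + 1) → ℤ} {ν : Fin m → ℤ}
    (h : Interlaces μ ν) : Weight.IsDominant ν :=
  h.antitone_right

/-- Calibration `m = 1` (`GL_2 ⊃ GL_1`): `(μ₀, μ₁) ≻ (ν₀)` iff `μ₁ ≤ ν₀ ≤ μ₀`.  With `μ = (k − 2, 0)`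
(weight-`k` modular forms, `CuspidalCohomologyGL 2 N ![k-2, 0]`) and `ν = (a)^∨ = (−a)` this is
`0 ≤ −a ≤ k − 2`: `k − 1` values of `a`, matching the periods `∫ f(z) zʲ dz`, `0 ≤ j ≤ k − 2`, i.e.
exactly the critical integers `s = j + 1 ∈ {1, …, k − 1}` of `L(f, s)`. [cite: Manin1972, §1] -/
theorem interlaces_two_iff (μ : Fin 2 → ℤ) (ν : Fin 1 → ℤ) :
    Interlaces μ ν ↔ ν 0 ≤ μ 0 ∧ μ 1 ≤ ν 0 := by
  simp only [Interlaces, Fin.forall_fin_one]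
  rfl

/-- **Symbol names** `[g, λ', N', c']` for the relative modular symbols of `GL_{m+1} ⊃ GL_m` over `ℚ`:
a finite-adelic `g ∈ GL_{m+1}(𝔸_ℚ^∞)` (the translate of the cycle; `g = u_f⁻¹` for the classical
cycle `Γ'_u y ↦ Γ u j(y)` of a rational `u` of positive determinant), a weight `λ'` of `GL_m`, a
level `N'`, and a class `c' ∈ H^{b_m}(S_m(K_f(N')), Ṽ_{λ'} ⊗ ℂ)` of the small group (cuspidal for
the printed theory; Eisenstein classes are allowed as names; `N' = 0` is the junk level `K_f((0))`
inherited from `GLnCohomology.level`).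
[cite: KastenSchmidt2012, §3.1 and §3.5] [cite: Januszewski2011, Prop. 1.4] -/
structure Name (m : ℕ) : Type where
  /-- the finite-adelic translate `g ∈ GL_{m+1}(𝔸_ℚ^∞)` -/
  g : BigHeckeGLn.FiniteAdelicGL (m + 1) ℚ
  /-- the weight `λ'` of the coefficient system `V_{λ'}` of the small group `GL_m` -/
  wt' : Fin m → ℤ
  /-- the level `N'` of the small group (`K_f^{(m)}(N')`) -/
  level : ℕ
  /-- the class `c' ∈ H^{b_m}(S_m(K_f(N')), Ṽ_{λ'} ⊗ ℂ)` -/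
  cls : levelCohomology ℂ m level wt' (bottomDegree m)

/-- A name is an **eigen-name** for a family `β` of Satake parameters if its class is a simultaneous
eigenclass of the `T_{v,i}`, `v ∤ N'`, with the Satake–Tamagawa eigenvalues of `β`
(`GLnCohomology.IsSatakeEigenclassAt`) — the names whose symbols carry `L(s, π × τ)` for the `τ` with
parameters `β` (the classes `[η']` attached to `σ` in [KastenSchmidt2012, §3.6]). [folklore] -/
def Name.IsEigen {m : ℕ} (s : Name m) (β : HeightOneSpectrum (𝓞 ℚ) → Multiset ℂ) : Prop :=
  ∀ v : HeightOneSpectrum (𝓞 ℚ), ¬ v.asIdeal ∣ Ideal.span {(s.level : 𝓞 ℚ)} →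
    IsSatakeEigenclassAt s.cls v (β v)

/-- The name of the CLASSICAL relative cycle of a rational `u` of positive determinant,
`Γ'_u y ↦ Γ u j(y)` (`Γ'_u = {γ' | j(γ') ∈ u⁻¹ Γ u}`): in the adelic model
`S(K_f) = GL_{m+1}(ℚ)⁺\(X⁺ × GL_{m+1}(𝔸^∞)/K_f)` one has `[u j(y), 1] = [j(y), u_f⁻¹]`, so the
translate is `g = u_f⁻¹` (`GLnCohomology.diagPos`). [cite: KastenSchmidt2012, §3.1 (the maps J_u)] -/
def Name.ofRat {m : ℕ} (u : Matrix.GLPos (Fin (m + 1)) ℚ) (wt' : Fin m → ℤ) (N' : ℕ)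
    (c : levelCohomology ℂ m N' wt' (bottomDegree m)) : Name m :=
  ⟨(diagPos (m + 1) u)⁻¹, wt', N', c⟩

end RelativeModularSymbol

open GLnCohomology RelativeModularSymbol Literature.NumberTheory.DiophantineGeometry _root_.NumberField in
/-- **A presentation by relative modular symbols** of the cuspidal (interior) cohomology
`CuspidalCohomologyGL (m+1) N wt = H^{b_{m+1}}_!(S_{m+1}(K_f(N)), Ṽ_λ ⊗ ℂ)` of `GL_{m+1}/ℚ`: for each
`g ∈ GL_{m+1}(𝔸_ℚ^∞)`, weight `λ'` and level `N'` of `GL_m`, a `ℂ`-linear map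
`c' ↦ [g, λ', N', c']` from `H^{b_m}(S_m(K_f(N')), Ṽ_{λ'} ⊗ ℂ)` to linear functionals on the
receptacle — in the printed theory, pairing (the canonical fast decreasing lift of) a cuspidal class
with the relative cycle `F_g(S_m) ⊂ S_{m+1}` capped with `c'` through the `GL_m`-invariant form on
`V_λ ⊗ V_{λ'}` [cite: KastenSchmidt2012, §3.3–§3.5] [cite: Januszewski2011, Prop. 1.4]
[cite: KazhdanMazurSchmidt2000, §3.3 (as used in KastenSchmidt2012 §3.1)] — subject to the formal
properties of that construction: the symbol is zero unless `λ ≻ λ'^∨` (no invariant form otherwise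
[cite: Raghuram2009, §2]), and it depends on `g` only through the double coset
`j(K_f^{(m)}(N')) g K_f(N)` (`F_{gu} = F_g`; `F_{j(u')g} = F_g ∘ R_{u'}` with `R_{u'} = id` on
`S_m(K_f(N'))`).  The symbol map is DATA (see the module docstring for why it is not constructed
here); `rel` is its relation module. -/
structure RelativeModularSymbolPresentation (m N : ℕ) (wt : Fin (m + 1) → ℤ) : Type where
  /-- the symbol `[g, λ', N', ·]`, linear in the class of the small group -/
  symbol : (g : BigHeckeGLn.FiniteAdelicGL (m + 1) ℚ) → (wt' : Fin m → ℤ) → (N' : ℕ) →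
    levelCohomology ℂ m N' wt' (bottomDegree m) →ₗ[ℂ]
      Module.Dual ℂ (CuspidalCohomologyGL (m + 1) N wt)
  /-- no `GL_m`-invariant form on `V_λ ⊗ V_{λ'}` unless `λ ≻ λ'^∨`: the symbol vanishes -/
  symbol_of_not_interlaces : ∀ g wt' N', ¬ Interlaces wt (Weight.dual wt') → symbol g wt' N' = 0
  /-- right `K_f(N)`-invariance in `g` (the cycle only depends on `g K_f(N)`) -/
  symbol_mul_of_mem : ∀ g wt' N', ∀ u ∈ level (m + 1) N, symbol (g * u) wt' N' = symbol g wt' N'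
  /-- left `j(K_f^{(m)}(N'))`-invariance in `g` (right translation by `u' ∈ K_f^{(m)}(N')` is the
  identity of `S_m(K_f(N'))`) -/
  symbol_cornerSucc_mul_of_mem : ∀ g wt' N', ∀ u' ∈ level m N',
    symbol (GLn.cornerSucc _ u' * g) wt' N' = symbol g wt' N'

namespace RelativeModularSymbolPresentation

open GLnCohomology RelativeModularSymbol Literature.NumberTheory.DiophantineGeometry _root_.NumberField

variable {m N : ℕ} {wt : Fin (m + 1) → ℤ} (P : RelativeModularSymbolPresentation m N wt)

/-- The symbol `[g, λ', N', c']` of a name, a functional on `CuspidalCohomologyGL (m+1) N wt`.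
[folklore] -/
def eval (s : Name m) : Module.Dual ℂ (CuspidalCohomologyGL (m + 1) N wt) :=
  P.symbol s.g s.wt' s.level s.cls

/-- Unfolding lemma for `eval`. [folklore] -/
@[simp]
theorem eval_mk (g : BigHeckeGLn.FiniteAdelicGL (m + 1) ℚ) (wt' : Fin m → ℤ) (N' : ℕ)
    (c : levelCohomology ℂ m N' wt' (bottomDegree m)) :
    P.eval ⟨g, wt', N', c⟩ = P.symbol g wt' N' c :=
  rfl

/-- **The relation module** `Rel(P) ⊆ ℂ[Name m]` of the presentation: the formal combinations of
symbol names vanishing identically on `CuspidalCohomologyGL (m+1) N wt`. [folklore] -/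
def rel : Submodule ℂ (Name m →₀ ℂ) :=
  SymbolPresentation.relationModule P.eval

/-- A value vector `Φ` on names (e.g. a vector of critical values) **kills the relation module**.
[folklore] -/
def Kills (Φ : Name m → ℂ) : Prop :=
  SymbolPresentation.Kills Φ P.rel

/-- The period vector `s ↦ [s](x)` of a class `x`. [folklore] -/
def periodVector (x : CuspidalCohomologyGL (m + 1) N wt) : Name m → ℂ :=
  SymbolPresentation.periodVector P.eval x

/-- The symbols of the presentation `Q` span the dual of the receptacle (separate its points) — a
PROPERTY of a presentation (conjectured for the Kazhdan–Mazur–Schmidt symbols by the requesting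
route, not asserted here). [folklore] -/
def IsSpanning (Q : RelativeModularSymbolPresentation m N wt) : Prop :=
  SymbolPresentation.IsSpanning Q.eval

/-- `F` generates the relation module of `P`. [folklore] -/
def IsGeneratedBy (F : Set (Name m →₀ ℂ)) : Prop :=
  SymbolPresentation.IsGeneratedBy F P.eval

/-- Membership in `rel`: the combination of symbols is the zero functional. [folklore] -/
theorem mem_rel_iff (r : Name m →₀ ℂ) :
    r ∈ P.rel ↔ Finsupp.linearCombination ℂ P.eval r = 0 :=
  SymbolPresentation.mem_relationModule_iff P.eval r

/-- Relations (a), additivity: `[g, c₁ + c₂] − [g, c₁] − [g, c₂] ∈ Rel`. [folklore] -/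
theorem single_add_mem_rel (g : BigHeckeGLn.FiniteAdelicGL (m + 1) ℚ) (wt' : Fin m → ℤ) (N' : ℕ)
    (c₁ c₂ : levelCohomology ℂ m N' wt' (bottomDegree m)) :
    Finsupp.single (⟨g, wt', N', c₁ + c₂⟩ : Name m) 1 - Finsupp.single ⟨g, wt', N', c₁⟩ 1 -
      Finsupp.single ⟨g, wt', N', c₂⟩ 1 ∈ P.rel :=
  SymbolPresentation.single_sub_single_sub_single_mem_relationModule (by simp)

/-- Relations (a), homogeneity: `[g, a • c] − a[g, c] ∈ Rel`. [folklore] -/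
theorem single_smul_mem_rel (g : BigHeckeGLn.FiniteAdelicGL (m + 1) ℚ) (wt' : Fin m → ℤ) (N' : ℕ)
    (a : ℂ) (c : levelCohomology ℂ m N' wt' (bottomDegree m)) :
    Finsupp.single (⟨g, wt', N', a • c⟩ : Name m) 1 - a • Finsupp.single ⟨g, wt', N', c⟩ 1 ∈ P.rel :=
  SymbolPresentation.single_sub_smul_single_mem_relationModule (by simp)

/-- Relations (b), right: `[g u, c'] − [g, c'] ∈ Rel` for `u ∈ K_f(N)`. [folklore] -/
theorem single_mul_sub_single_mem_rel (g : BigHeckeGLn.FiniteAdelicGL (m + 1) ℚ) (wt' : Fin m → ℤ)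
    (N' : ℕ) (c : levelCohomology ℂ m N' wt' (bottomDegree m))
    {u : BigHeckeGLn.FiniteAdelicGL (m + 1) ℚ} (hu : u ∈ level (m + 1) N) :
    Finsupp.single (⟨g * u, wt', N', c⟩ : Name m) 1 - Finsupp.single ⟨g, wt', N', c⟩ 1 ∈ P.rel :=
  SymbolPresentation.single_sub_single_mem_relationModule
    (by simp [P.symbol_mul_of_mem g wt' N' u hu])

/-- Relations (b), left ("`g ∼ g h`"): `[j(u') g, c'] − [g, c'] ∈ Rel` for `u' ∈ K_f^{(m)}(N')`.
[folklore] -/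
theorem single_cornerSucc_mul_sub_single_mem_rel (g : BigHeckeGLn.FiniteAdelicGL (m + 1) ℚ)
    (wt' : Fin m → ℤ) (N' : ℕ) (c : levelCohomology ℂ m N' wt' (bottomDegree m))
    {u' : BigHeckeGLn.FiniteAdelicGL m ℚ} (hu' : u' ∈ level m N') :
    Finsupp.single (⟨GLn.cornerSucc _ u' * g, wt', N', c⟩ : Name m) 1 -
      Finsupp.single ⟨g, wt', N', c⟩ 1 ∈ P.rel :=
  SymbolPresentation.single_sub_single_mem_relationModule
    (by simp [P.symbol_cornerSucc_mul_of_mem g wt' N' u' hu'])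

/-- Relations (b), classical form: `[γ u] = [u]` for `γ` in the arithmetic group
`Γ = {γ ∈ GL_{m+1}(ℚ)⁺ | γ_f ∈ K_f(N)}` (left invariance of the cycle `Γ'_u y ↦ Γ u j(y)`; adelically
`(γu)_f⁻¹ = u_f⁻¹ γ_f⁻¹`). [cite: KastenSchmidt2012, §3.1] -/
theorem single_ofRat_mul_sub_single_mem_rel {γ : Matrix.GLPos (Fin (m + 1)) ℚ}
    (hγ : diagPos (m + 1) γ ∈ level (m + 1) N) (u : Matrix.GLPos (Fin (m + 1)) ℚ) (wt' : Fin m → ℤ)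
    (N' : ℕ) (c : levelCohomology ℂ m N' wt' (bottomDegree m)) :
    Finsupp.single (Name.ofRat (γ * u) wt' N' c) 1 -
      Finsupp.single (Name.ofRat u wt' N' c) 1 ∈ P.rel := by
  refine SymbolPresentation.single_sub_single_mem_relationModule ?_
  change P.symbol (diagPos (m + 1) (γ * u))⁻¹ wt' N' c = P.symbol (diagPos (m + 1) u)⁻¹ wt' N' c
  rw [map_mul, mul_inv_rev, P.symbol_mul_of_mem _ wt' N' _ (inv_mem hγ)]

/-- The relation module among the names satisfying a predicate `p` (eigen-names, cuspidal classes, a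
finite probe set, …): the relation module of the restricted symbol map; every result of
`SymbolPresentation` applies to it verbatim. [folklore] -/
def relOn (p : Name m → Prop) : Submodule ℂ ({s : Name m // p s} →₀ ℂ) :=
  SymbolPresentation.relationModule fun s : {s : Name m // p s} => P.eval s.1

/-- Non-interlacing names are relations: `[g, λ', N', c'] ∈ Rel` unless `λ ≻ λ'^∨`. [folklore] -/
theorem single_mem_rel_of_not_interlaces (g : BigHeckeGLn.FiniteAdelicGL (m + 1) ℚ)
    {wt' : Fin m → ℤ} (h : ¬ Interlaces wt (Weight.dual wt')) (N' : ℕ)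
    (c : levelCohomology ℂ m N' wt' (bottomDegree m)) :
    Finsupp.single (⟨g, wt', N', c⟩ : Name m) 1 ∈ P.rel :=
  SymbolPresentation.single_mem_relationModule (by simp [P.symbol_of_not_interlaces g wt' N' h])

/-- Period vectors of classes kill the relation module. [folklore] -/
theorem kills_periodVector (x : CuspidalCohomologyGL (m + 1) N wt) : P.Kills (P.periodVector x) :=
  SymbolPresentation.kills_relationModule_periodVector P.eval x

/-- **Duality for the presentation**: a value vector kills `Rel(P)` iff it factors through a
functional on the dual of the receptacle; … [folklore] -/
theorem kills_iff_exists_dual (Φ : Name m → ℂ) :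
    P.Kills Φ ↔ ∃ ψ : Module.Dual ℂ (Module.Dual ℂ (CuspidalCohomologyGL (m + 1) N wt)),
      ∀ s, Φ s = ψ (P.eval s) :=
  SymbolPresentation.kills_relationModule_iff_exists_dual P.eval Φ

/-- … and, when the receptacle is finite-dimensional, **iff it is the period vector of a class**
(unique when the symbols span, `SymbolPresentation.existsUnique_of_kills`). [folklore] -/
theorem kills_iff_exists_eq [FiniteDimensional ℂ (CuspidalCohomologyGL (m + 1) N wt)]
    (Φ : Name m → ℂ) : P.Kills Φ ↔ ∃ x, Φ = P.periodVector x :=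
  SymbolPresentation.kills_relationModule_iff P.eval Φ

/-- With a generating family `F` of `Rel(P)`, killing it is the list of identities indexed by `F`.
[folklore] -/
theorem kills_iff_of_isGeneratedBy {F : Set (Name m →₀ ℂ)} (hF : P.IsGeneratedBy F)
    (Φ : Name m → ℂ) : P.Kills Φ ↔ ∀ f ∈ F, Finsupp.linearCombination ℂ Φ f = 0 :=
  SymbolPresentation.kills_relationModule_iff_of_isGeneratedBy hF Φ

/-- The zero presentation (all symbols zero; its relation module is everything): the structure is
non-vacuous. [folklore] -/
protected def zero (m N : ℕ) (wt : Fin (m + 1) → ℤ) : RelativeModularSymbolPresentation m N wt where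
  symbol _ _ _ := 0
  symbol_of_not_interlaces _ _ _ _ := rfl
  symbol_mul_of_mem _ _ _ _ _ := rfl
  symbol_cornerSucc_mul_of_mem _ _ _ _ _ := rfl

/-- Presentations exist (the zero one). [folklore] -/
instance (m N : ℕ) (wt : Fin (m + 1) → ℤ) : Inhabited (RelativeModularSymbolPresentation m N wt) :=
  ⟨RelativeModularSymbolPresentation.zero m N wt⟩

/-- The relation module of the zero presentation is everything. [folklore] -/
theorem rel_zero (m N : ℕ) (wt : Fin (m + 1) → ℤ) :
    (RelativeModularSymbolPresentation.zero m N wt).rel = ⊤ := by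
  refine eq_top_iff.2 fun r _ => ?_
  rw [mem_rel_iff]
  have : (RelativeModularSymbolPresentation.zero m N wt).eval = 0 := rfl
  rw [this, Finsupp.linearCombination_zero, LinearMap.zero_apply]

end RelativeModularSymbolPresentation

end Literature.NumberTheory.Automorphic
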